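import Literature.NumberTheory.QuadraticFields.Sqrt41Places
import Literature.NumberTheory.EllipticCurves.TwoDescentLocalPadic
import Literature.NumberTheory.EllipticCurves.TwoDescentInertPlace
import Literature.NumberTheory.EllipticCurves.TwoDescentCharSum
import HarnessLib

/-!
# `rk E(F₄)` for `E = 480a1`: the `2`-descent over `ℚ(√41)`, I — the group `K(S, 2)` in coordinates

Data for the complete `2`-descent of `E = 480a1 : y² = x(x + 2)(x - 3)` over `K = ℚ(√41)`
(T. Dokchitser–V. Dokchitser, *A note on the Mordell–Weil rank modulo n*, J. Number Theory 131
(2011), proof of Thm. 2: "2-descent … over all minimal non-trivial subfields of `F₄`"), with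
`S = {∞⁺, ∞⁻, 𝔭₂, 𝔭₂', (3), 𝔭₅, 𝔭₅'}` the places of `K` above `∞, 2, 3, 5`
(`Literature/NumberTheory/QuadraticFields/Sqrt41*.lean`: `h_K = 1`, units `±ε^ℤ`, `N ε = -1`).

* The seven **structural bits** of `z ∈ Kˣ` (`Bits z ∈ 𝔽₂⁷`): the signs `s⁺, s⁻` at the real
  embeddings, the parities `a⁺, a⁻` of `v₂ ∘ ι±`, `a₃` of `ord_(3) = v₃ ∘ N / 2`, `b⁺, b⁻` of
  `v₅ ∘ κ±`; each is additive on products (`Bits_mul`).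
* The basis `-1, ε = 32 + 5√41, π₂ = (7 + √41)/2, 2, 3, π₅ = 6 + √41, 5` of `K(S, 2)` and its
  bit table (`Bits_neg_one`, …, `Bits_five`), from the `2`-adic / `5`-adic expansions
  `√41 = 13 + 64t`, `√41 = 21 + 25t'`.

Everything is proved (definitions + theorems, no named facts). The character sum and the values
of the non-structural characters follow in part II.

## References

* T. Dokchitser, V. Dokchitser, *A note on the Mordell–Weil rank modulo n*, J. Number Theory 131
  (2011) 1833–1839, proof of Thm. 2. [DokchitserDokchitser2011RankModN]
* J. H. Silverman, *The Arithmetic of Elliptic Curves*, 2nd ed. (2009), Prop. VIII.1.6, X.1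
  (the group `K(S, 2)`), Example X.1.5. [SilvermanAEC2009]
-/

noncomputable section

open NumberField QuadraticAlgebra IsDedekindDomain IsDedekindDomain.HeightOneSpectrum WithZero
open WeierstrassCurve.Affine
open Literature.NumberTheory.QuadraticFields.Sqrt41
open Literature.NumberTheory.NumberFields
open Literature.NumberTheory.EllipticCurves.TwoDescentLocal
open Literature.NumberTheory.EllipticCurves.KramerTwoDescent

namespace Literature.Barriers.BirchSwinnertonDyer

namespace DokchitserDokchitser2011

namespace K41D

/-! ### `p`-adic evaluation helpers -/

/-- An integer prime to `p` is a `p`-adic unit. [folklore] -/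
theorem norm_intCast_eq_one {p : ℕ} [Fact p.Prime] {n : ℤ} (hn : ¬ (p : ℤ) ∣ n) :
    ‖(n : ℚ_[p])‖ = 1 :=
  le_antisymm (Padic.norm_int_le_one n) (not_lt.mp (mt Padic.norm_intCast_lt_one_iff.mp hn))

/-- An integer divisible by `p` has norm `< 1`. [folklore] -/
theorem norm_intCast_lt_one {p : ℕ} [Fact p.Prime] {m : ℤ} (hm : (p : ℤ) ∣ m) :
    ‖(m : ℚ_[p])‖ < 1 :=
  Padic.norm_intCast_lt_one_iff.mpr hm

/-- `n + m t` is a `p`-adic unit for `p ∤ n`, `p ∣ m`, `t ∈ ℤ_p`. [folklore] -/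
theorem norm_intCast_add_mul {p : ℕ} [Fact p.Prime] {n m : ℤ} (hn : ¬ (p : ℤ) ∣ n)
    (hm : (p : ℤ) ∣ m) (t : ℤ_[p]) : ‖(n : ℚ_[p]) + (m : ℚ_[p]) * (t : ℚ_[p])‖ = 1 :=
  norm_add_mul_eq_one (norm_intCast_eq_one hn) t (norm_intCast_lt_one hm)

/-- `n + m t ≠ 0` and `v_p(n + m t) = 0`. [folklore] -/
theorem valuation_intCast_add_mul {p : ℕ} [Fact p.Prime] {n m : ℤ} (hn : ¬ (p : ℤ) ∣ n)
    (hm : (p : ℤ) ∣ m) (t : ℤ_[p]) :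
    (n : ℚ_[p]) + (m : ℚ_[p]) * (t : ℚ_[p]) ≠ 0 ∧
      ((n : ℚ_[p]) + (m : ℚ_[p]) * (t : ℚ_[p])).valuation = 0 := by
  have h := norm_intCast_add_mul hn hm t
  refine ⟨fun h0 => ?_, valuation_eq_zero_of_norm_eq_one h⟩
  rw [h0, _root_.norm_zero] at h; exact zero_ne_one h

/-- The residue mod `p^k` of a unit `u ∈ ℚ_p` is that of `u` seen in `ℤ_p`. [folklore] -/
theorem presPow_eq_of_norm_eq_one {p : ℕ} [Fact p.Prime] (k : ℕ) {u : ℚ_[p]} (hu : ‖u‖ = 1) :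
    presPow p k u = PadicInt.toZModPow k (⟨u, hu.le⟩ : ℤ_[p]) := by
  have h : punitInt p u = (⟨u, hu.le⟩ : ℤ_[p]) := by
    apply PadicInt.ext
    change punit p u = u
    exact punit_of_valuation_eq_zero p (valuation_eq_zero_of_norm_eq_one hu)
  rw [presPow, h]

/-- The residue in `𝔽_p` of a unit `u ∈ ℚ_p` is that of `u` seen in `ℤ_p`. [folklore] -/
theorem pres_eq_of_norm_eq_one {p : ℕ} [Fact p.Prime] {u : ℚ_[p]} (hu : ‖u‖ = 1) :
    pres p u = PadicInt.toZMod (⟨u, hu.le⟩ : ℤ_[p]) := by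
  have h : punitInt p u = (⟨u, hu.le⟩ : ℤ_[p]) := by
    apply PadicInt.ext
    change punit p u = u
    exact punit_of_valuation_eq_zero p (valuation_eq_zero_of_norm_eq_one hu)
  rw [pres, h]

/-- **Residues of `n + m t` modulo `p^k`** (`p ∤ n`, `p^k ∣ m`, `p ∣ m`): `n`. [folklore] -/
theorem presPow_intCast_add_mul {p : ℕ} [Fact p.Prime] (k : ℕ) {n m : ℤ} (hn : ¬ (p : ℤ) ∣ n)
    (hm : ((p : ℤ) ^ k) ∣ m) (hm1 : (p : ℤ) ∣ m) (t : ℤ_[p]) :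
    presPow p k ((n : ℚ_[p]) + (m : ℚ_[p]) * (t : ℚ_[p])) = (n : ZMod (p ^ k)) := by
  have hu := norm_intCast_add_mul hn hm1 t
  rw [presPow_eq_of_norm_eq_one k hu]
  have e : (⟨(n : ℚ_[p]) + (m : ℚ_[p]) * (t : ℚ_[p]), hu.le⟩ : ℤ_[p]) = (n : ℤ_[p]) + (m : ℤ_[p]) * t := by
    apply PadicInt.ext; simp
  rw [e, map_add, map_mul, map_intCast, map_intCast]
  have hm0 : ((m : ℤ) : ZMod (p ^ k)) = 0 := by
    rw [ZMod.intCast_zmod_eq_zero_iff_dvd]; exact_mod_cast hm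
  rw [hm0, zero_mul, add_zero]

/-- **Residues of `n + m t` in `𝔽_p`** (`p ∤ n`, `p ∣ m`): `n`. [folklore] -/
theorem pres_intCast_add_mul {p : ℕ} [Fact p.Prime] {n m : ℤ} (hn : ¬ (p : ℤ) ∣ n)
    (hm : (p : ℤ) ∣ m) (t : ℤ_[p]) :
    pres p ((n : ℚ_[p]) + (m : ℚ_[p]) * (t : ℚ_[p])) = (n : ZMod p) := by
  have hu := norm_intCast_add_mul hn hm t
  rw [pres_eq_of_norm_eq_one hu]
  have e : (⟨(n : ℚ_[p]) + (m : ℚ_[p]) * (t : ℚ_[p]), hu.le⟩ : ℤ_[p]) = (n : ℤ_[p]) + (m : ℤ_[p]) * t := by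
    apply PadicInt.ext; simp
  rw [e, map_add, map_mul, map_intCast, map_intCast]
  have hm0 : ((m : ℤ) : ZMod p) = 0 := by
    rw [ZMod.intCast_zmod_eq_zero_iff_dvd]; exact_mod_cast hm
  rw [hm0, zero_mul, add_zero]

/-! ### The places of `K` above `2, 3, 5` as abstract odd places; the structural bits -/

/-- `v₃(41) = 0` and `41 ≡ 2` is a non-square mod `3`: `3` is inert in `K`. [folklore] -/
theorem inert_three_data : padicValRat 3 (41 : ℚ) = 0 ∧ ¬ IsSquare (res 3 (41 : ℚ)) := by
  haveI : Fact (Nat.Prime 3) := ⟨Nat.prime_three⟩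
  refine ⟨?_, ?_⟩
  · rw [show (41 : ℚ) = ((41 : ℕ) : ℚ) by norm_num, padicValRat.of_nat]
    simp [padicValNat.eq_zero_of_not_dvd (show ¬ 3 ∣ 41 by norm_num)]
  · rw [res_three_values.2.2.2.2.1]
    exact isSquare_values.1

/-- The inert place `(3)` of `K`. [folklore] -/
def 𝔳3 : OddPlace K :=
  haveI : Fact (Nat.Prime 3) := ⟨Nat.prime_three⟩
  inertPlace 3 41 inert_three_data.1 inert_three_data.2

/-- The sign bit at `σ⁺`. [folklore] -/
def sP (z : K) : ZMod 2 := rsign (σpos z)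
/-- The sign bit at `σ⁻`. [folklore] -/
def sN (z : K) : ZMod 2 := rsign (σneg z)
/-- The parity of `v₂ ∘ ι⁺`. [folklore] -/
def aP (z : K) : ZMod 2 := ((ιpos z).valuation : ZMod 2)
/-- The parity of `v₂ ∘ ι⁻`. [folklore] -/
def aN (z : K) : ZMod 2 := ((ιneg z).valuation : ZMod 2)
/-- The parity of `ord_(3) = v₃ ∘ N / 2`. [folklore] -/
def a3 (z : K) : ZMod 2 := 𝔳3.parity z
/-- The parity of `v₅ ∘ κ⁺`. [folklore] -/
def bP (z : K) : ZMod 2 := ((κpos z).valuation : ZMod 2)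
/-- The parity of `v₅ ∘ κ⁻`. [folklore] -/
def bN (z : K) : ZMod 2 := ((κneg z).valuation : ZMod 2)

/-- The coordinate space `𝔽₂⁷` of the structural bits. [folklore] -/
abbrev V7 : Type := ZMod 2 × ZMod 2 × ZMod 2 × ZMod 2 × ZMod 2 × ZMod 2 × ZMod 2

set_option synthInstance.maxSize 512 in
/-- Decidable equality on `𝔽₂⁷` (the default instance search size does not reach a seven-fold
product). [folklore] -/
instance instDecEqV7 : DecidableEq V7 := inferInstance

/-- **The structural bits** `(s⁺, s⁻, a⁺, a⁻, a₃, b⁺, b⁻)` of `z ∈ K`. [folklore] -/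
def Bits (z : K) : V7 := (sP z, sN z, aP z, aN z, a3 z, bP z, bN z)

/-- Unfolding `a3`: the parity of `v₃(N z)/2`. [folklore] -/
theorem a3_eq (z : K) : a3 z = ((padicValRat 3 z.norm / 2 : ℤ) : ZMod 2) := rfl

/-- The sign bits are additive on products. [folklore] -/
theorem sP_mul {z w : K} (hz : z ≠ 0) (hw : w ≠ 0) : sP (z * w) = sP z + sP w := by
  rw [sP, sP, sP, map_mul, rsign_mul ((map_ne_zero σpos).mpr hz) ((map_ne_zero σpos).mpr hw)]

/-- The sign bits are additive on products. [folklore] -/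
theorem sN_mul {z w : K} (hz : z ≠ 0) (hw : w ≠ 0) : sN (z * w) = sN z + sN w := by
  rw [sN, sN, sN, map_mul, rsign_mul ((map_ne_zero σneg).mpr hz) ((map_ne_zero σneg).mpr hw)]

/-- `a⁺` is additive on products. [folklore] -/
theorem aP_mul {z w : K} (hz : z ≠ 0) (hw : w ≠ 0) : aP (z * w) = aP z + aP w := by
  rw [aP, aP, aP, map_mul, Padic.valuation_mul ((map_ne_zero ιpos).mpr hz) ((map_ne_zero ιpos).mpr hw),
    Int.cast_add]

/-- `a⁻` is additive on products. [folklore] -/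
theorem aN_mul {z w : K} (hz : z ≠ 0) (hw : w ≠ 0) : aN (z * w) = aN z + aN w := by
  rw [aN, aN, aN, map_mul, Padic.valuation_mul ((map_ne_zero ιneg).mpr hz) ((map_ne_zero ιneg).mpr hw),
    Int.cast_add]

/-- `a₃` is additive on products. [folklore] -/
theorem a3_mul {z w : K} (hz : z ≠ 0) (hw : w ≠ 0) : a3 (z * w) = a3 z + a3 w :=
  𝔳3.parity_mul hz hw

/-- `b⁺` is additive on products. [folklore] -/
theorem bP_mul {z w : K} (hz : z ≠ 0) (hw : w ≠ 0) : bP (z * w) = bP z + bP w := by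
  rw [bP, bP, bP, map_mul, Padic.valuation_mul ((map_ne_zero κpos).mpr hz) ((map_ne_zero κpos).mpr hw),
    Int.cast_add]

/-- `b⁻` is additive on products. [folklore] -/
theorem bN_mul {z w : K} (hz : z ≠ 0) (hw : w ≠ 0) : bN (z * w) = bN z + bN w := by
  rw [bN, bN, bN, map_mul, Padic.valuation_mul ((map_ne_zero κneg).mpr hz) ((map_ne_zero κneg).mpr hw),
    Int.cast_add]

/-- **The structural bits are additive on products.** [folklore] -/
theorem Bits_mul {z w : K} (hz : z ≠ 0) (hw : w ≠ 0) : Bits (z * w) = Bits z + Bits w := by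
  simp only [Bits, sP_mul hz hw, sN_mul hz hw, aP_mul hz hw, aN_mul hz hw, a3_mul hz hw, bP_mul hz hw,
    bN_mul hz hw, Prod.mk_add_mk]

/-- The bits of `1` vanish. [folklore] -/
theorem Bits_one : Bits (1 : K) = 0 := by
  have h := Bits_mul (one_ne_zero (α := K)) one_ne_zero
  rw [mul_one] at h
  have : Bits (1 : K) + Bits 1 - Bits 1 = Bits 1 - Bits 1 := by rw [← h]
  simpa using this

/-! ### The basis of `K(S, 2)` -/

/-- `ε = 32 + 5√41` in `K`. [folklore] -/
def εK : K := ⟨32, 5⟩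
/-- `π₂ = (7 + √41)/2` in `K`. [folklore] -/
def π₂K : K := ⟨7 / 2, 1 / 2⟩
/-- `π₅ = 6 + √41` in `K`. [folklore] -/
def π₅K : K := ⟨6, 1⟩

/-- `εK` is the unit `ε` of `𝓞 K`. [folklore] -/
theorem εK_eq : εK = (((unitEps : (𝓞 K)ˣ) : 𝓞 K) : K) := coe_unitEps.symm

/-- `π₂K` is `π₂ ∈ 𝓞 K`. [folklore] -/
theorem π₂K_eq : π₂K = ((π₂ : 𝓞 K) : K) := by
  rw [coe_π₂, π₂K]
  ext
  · simp [φ]; norm_num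
  · simp [φ]

/-- `π₅K` is `π₅ ∈ 𝓞 K`. [folklore] -/
theorem π₅K_eq : π₅K = ((π₅ : 𝓞 K) : K) := by
  rw [coe_π₅, π₅K]; ext <;> simp [θ]

/-- The basis elements are non-zero. [folklore] -/
theorem gens_ne_zero : (-1 : K) ≠ 0 ∧ εK ≠ 0 ∧ π₂K ≠ 0 ∧ (2 : K) ≠ 0 ∧ (3 : K) ≠ 0 ∧ π₅K ≠ 0 ∧
    (5 : K) ≠ 0 := by
  refine ⟨by norm_num, ?_, ?_, by norm_num, by norm_num, ?_, by norm_num⟩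
  · intro h; have := congrArg QuadraticAlgebra.im h; simp [εK] at this
  · intro h; have := congrArg QuadraticAlgebra.im h; simp [π₂K] at this
  · intro h; have := congrArg QuadraticAlgebra.im h; simp [π₅K] at this

/-! ### Values of the embeddings on the basis -/

section Expansions

/-- `ι⁺ ε = 97 + 320 t`, `ι⁻ ε = -33 - 320 t`, `ι⁺ π₂ = 2 (5 + 16 t)`, `ι⁻ π₂ = -3 - 32 t`,
`ι⁺ π₅ = 19 + 64 t`, `ι⁻ π₅ = -7 - 64 t` for `√41 = 13 + 64 t` in `ℤ₂`. [folklore] -/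
theorem ι_values {t : ℤ_[2]} (ht : sqrt41Two = 13 + 2 ^ 6 * t) :
    ιpos εK = ((97 : ℤ) : ℚ_[2]) + ((320 : ℤ) : ℚ_[2]) * (t : ℚ_[2]) ∧
    ιneg εK = ((-33 : ℤ) : ℚ_[2]) + ((-320 : ℤ) : ℚ_[2]) * (t : ℚ_[2]) ∧
    ιpos π₂K = 2 * (((5 : ℤ) : ℚ_[2]) + ((16 : ℤ) : ℚ_[2]) * (t : ℚ_[2])) ∧
    ιneg π₂K = ((-3 : ℤ) : ℚ_[2]) + ((-32 : ℤ) : ℚ_[2]) * (t : ℚ_[2]) ∧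
    ιpos π₅K = ((19 : ℤ) : ℚ_[2]) + ((64 : ℤ) : ℚ_[2]) * (t : ℚ_[2]) ∧
    ιneg π₅K = ((-7 : ℤ) : ℚ_[2]) + ((-64 : ℤ) : ℚ_[2]) * (t : ℚ_[2]) := by
  have hr := coe_sqrt41Two_eq ht
  refine ⟨?_, ?_, ?_, ?_, ?_, ?_⟩ <;>
    simp only [ιpos_apply, ιneg_apply, εK, π₂K, π₅K, hr] <;> push_cast <;> ring

/-- `κ⁺ ε = 137 + 125 t`, `κ⁻ ε = -73 - 125 t`, `κ⁺ π₂ = 2⁻¹ (28 + 25 t)`,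
`κ⁻ π₂ = 2⁻¹ (-14 - 25 t)`, `κ⁺ π₅ = 27 + 25 t`, `κ⁻ π₅ = 5 (-3 - 5t)` for `√41 = 21 + 25 t` in
`ℤ₅`. [folklore] -/
theorem κ_values {t : ℤ_[5]} (ht : sqrt41Five = 21 + 5 ^ 2 * t) :
    κpos εK = ((137 : ℤ) : ℚ_[5]) + ((125 : ℤ) : ℚ_[5]) * (t : ℚ_[5]) ∧
    κneg εK = ((-73 : ℤ) : ℚ_[5]) + ((-125 : ℤ) : ℚ_[5]) * (t : ℚ_[5]) ∧
    κpos π₂K = 2⁻¹ * (((28 : ℤ) : ℚ_[5]) + ((25 : ℤ) : ℚ_[5]) * (t : ℚ_[5])) ∧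
    κneg π₂K = 2⁻¹ * (((-14 : ℤ) : ℚ_[5]) + ((-25 : ℤ) : ℚ_[5]) * (t : ℚ_[5])) ∧
    κpos π₅K = ((27 : ℤ) : ℚ_[5]) + ((25 : ℤ) : ℚ_[5]) * (t : ℚ_[5]) ∧
    κneg π₅K = 5 * (((-3 : ℤ) : ℚ_[5]) + ((-5 : ℤ) : ℚ_[5]) * (t : ℚ_[5])) := by
  have hr := coe_sqrt41Five_eq ht
  refine ⟨?_, ?_, ?_, ?_, ?_, ?_⟩ <;>
    simp only [κpos_apply, κneg_apply, εK, π₂K, π₅K, hr] <;> push_cast <;> ring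

end Expansions

/-! ### The bit table of the basis -/

/-- Signs of the basis elements: only `-1` (both), `ε` (at `σ⁻`) and `π₅` (at `σ⁻`) are
negative. [folklore] -/
theorem signs_values :
    (sP (-1 : K) = 1 ∧ sN (-1 : K) = 1) ∧ (sP εK = 0 ∧ sN εK = 1) ∧ (sP π₂K = 0 ∧ sN π₂K = 0) ∧
    (sP π₅K = 0 ∧ sN π₅K = 1) ∧
    (∀ n : ℕ, sP (n : K) = 0 ∧ sN (n : K) = 0) := by
  obtain ⟨h6, h7, h32⟩ := sqrt41_bounds
  have pos : ∀ {x : ℝ}, 0 < x → rsign x = 0 := fun hx => by rw [rsign, if_neg (not_lt.mpr hx.le)]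
  have neg : ∀ {x : ℝ}, x < 0 → rsign x = 1 := fun hx => by rw [rsign, if_pos hx]
  refine ⟨⟨?_, ?_⟩, ⟨?_, ?_⟩, ⟨?_, ?_⟩, ⟨?_, ?_⟩, fun n => ⟨?_, ?_⟩⟩
  · rw [sP, map_neg, map_one]; exact neg (by norm_num)
  · rw [sN, map_neg, map_one]; exact neg (by norm_num)
  · rw [sP, σpos_apply]; simp only [εK]; push_cast; exact pos (by positivity)
  · rw [sN, σneg_apply]; simp only [εK]; push_cast; exact neg (by linarith)
  · rw [sP, σpos_apply]; simp only [π₂K]; push_cast; exact pos (by positivity)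
  · rw [sN, σneg_apply]; simp only [π₂K]; push_cast; exact pos (by linarith)
  · rw [sP, σpos_apply]; simp only [π₅K]; push_cast; exact pos (by positivity)
  · rw [sN, σneg_apply]; simp only [π₅K]; push_cast; exact neg (by linarith)
  · rw [sP, map_natCast, rsign, if_neg (not_lt.mpr (Nat.cast_nonneg n))]
  · rw [sN, map_natCast, rsign, if_neg (not_lt.mpr (Nat.cast_nonneg n))]

/-- `2`-adic parities of the basis elements: `a⁺ = 1` exactly for `π₂, 2`; `a⁻ = 1` exactly for
`2`. [folklore] -/
theorem a_values :
    (aP (-1 : K) = 0 ∧ aN (-1 : K) = 0) ∧ (aP εK = 0 ∧ aN εK = 0) ∧ (aP π₂K = 1 ∧ aN π₂K = 0) ∧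
    (aP (2 : K) = 1 ∧ aN (2 : K) = 1) ∧ (aP (3 : K) = 0 ∧ aN (3 : K) = 0) ∧
    (aP π₅K = 0 ∧ aN π₅K = 0) ∧ (aP (5 : K) = 0 ∧ aN (5 : K) = 0) := by
  obtain ⟨t, ht⟩ := exists_sqrt41Two_eq
  obtain ⟨e1, e2, e3, e4, e5, e6⟩ := ι_values ht
  have hu : ∀ {n m : ℤ}, ¬ (2 : ℤ) ∣ n → (2 : ℤ) ∣ m →
      ((((n : ℚ_[2]) + (m : ℚ_[2]) * (t : ℚ_[2])).valuation : ℤ) : ZMod 2) = 0 := by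
    intro n m hn hm; rw [(valuation_intCast_add_mul hn hm t).2, Int.cast_zero]
  have hint : ∀ (τ : K →ₐ[ℚ] ℚ_[2]) {n : ℤ}, ¬ (2 : ℤ) ∣ n → (((τ (n : K)).valuation : ℤ) : ZMod 2) = 0 := by
    intro τ n hn
    rw [map_intCast, show ((n : ℚ_[2])) = ((n : ℚ) : ℚ_[2]) by push_cast; rfl, Padic.valuation_ratCast,
      padicValRat.of_int, padicValInt.eq_zero_of_not_dvd hn]; rfl
  refine ⟨⟨?_, ?_⟩, ⟨?_, ?_⟩, ⟨?_, ?_⟩, ⟨?_, ?_⟩, ⟨?_, ?_⟩, ⟨?_, ?_⟩, ⟨?_, ?_⟩⟩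
  · rw [aP, show (-1 : K) = ((-1 : ℤ) : K) by norm_num]; exact hint ιpos (by decide)
  · rw [aN, show (-1 : K) = ((-1 : ℤ) : K) by norm_num]; exact hint ιneg (by decide)
  · rw [aP, e1]; exact hu (by decide) (by decide)
  · rw [aN, e2]; exact hu (by decide) (by decide)
  · rw [aP, π₂K_eq, valuation_ιpos_π₂]; rfl
  · rw [aN, e4]; exact hu (by decide) (by decide)
  · rw [aP, map_ofNat, valuation_two']; rfl
  · rw [aN, map_ofNat, valuation_two']; rfl
  · rw [aP, show (3 : K) = ((3 : ℤ) : K) by norm_num]; exact hint ιpos (by decide)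
  · rw [aN, show (3 : K) = ((3 : ℤ) : K) by norm_num]; exact hint ιneg (by decide)
  · rw [aP, e5]; exact hu (by decide) (by decide)
  · rw [aN, e6]; exact hu (by decide) (by decide)
  · rw [aP, show (5 : K) = ((5 : ℤ) : K) by norm_num]; exact hint ιpos (by decide)
  · rw [aN, show (5 : K) = ((5 : ℤ) : K) by norm_num]; exact hint ιneg (by decide)

/-- `5`-adic parities of the basis elements: `b⁺ = 1` exactly for `5`; `b⁻ = 1` exactly for
`π₅, 5`. [folklore] -/
theorem b_values :
    (bP (-1 : K) = 0 ∧ bN (-1 : K) = 0) ∧ (bP εK = 0 ∧ bN εK = 0) ∧ (bP π₂K = 0 ∧ bN π₂K = 0) ∧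
    (bP (2 : K) = 0 ∧ bN (2 : K) = 0) ∧ (bP (3 : K) = 0 ∧ bN (3 : K) = 0) ∧
    (bP π₅K = 0 ∧ bN π₅K = 1) ∧ (bP (5 : K) = 1 ∧ bN (5 : K) = 1) := by
  obtain ⟨t, ht⟩ := exists_sqrt41Five_eq
  obtain ⟨e1, e2, e3, e4, e5, e6⟩ := κ_values ht
  have hu : ∀ {n m : ℤ}, ¬ (5 : ℤ) ∣ n → (5 : ℤ) ∣ m →
      ((((n : ℚ_[5]) + (m : ℚ_[5]) * (t : ℚ_[5])).valuation : ℤ) : ZMod 2) = 0 := by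
    intro n m hn hm; rw [(valuation_intCast_add_mul hn hm t).2, Int.cast_zero]
  have hint : ∀ (τ : K →ₐ[ℚ] ℚ_[5]) {n : ℤ}, ¬ (5 : ℤ) ∣ n → (((τ (n : K)).valuation : ℤ) : ZMod 2) = 0 := by
    intro τ n hn
    rw [map_intCast, show ((n : ℚ_[5])) = ((n : ℚ) : ℚ_[5]) by push_cast; rfl, Padic.valuation_ratCast,
      padicValRat.of_int, padicValInt.eq_zero_of_not_dvd hn]; rfl
  have h2 : (2 : ℚ_[5])⁻¹.valuation = 0 := by
    rw [Padic.valuation_inv, show (2 : ℚ_[5]) = ((2 : ℚ) : ℚ_[5]) by norm_num, Padic.valuation_ratCast,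
      show (2 : ℚ) = ((2 : ℤ) : ℚ) by norm_num, padicValRat.of_int,
      padicValInt.eq_zero_of_not_dvd (by decide)]; rfl
  have hhalf : ∀ {n m : ℤ}, ¬ (5 : ℤ) ∣ n → (5 : ℤ) ∣ m →
      ((((2 : ℚ_[5])⁻¹ * ((n : ℚ_[5]) + (m : ℚ_[5]) * (t : ℚ_[5]))).valuation : ℤ) : ZMod 2) = 0 := by
    intro n m hn hm
    obtain ⟨hne, hv⟩ := valuation_intCast_add_mul hn hm t
    rw [Padic.valuation_mul (inv_ne_zero (by norm_num)) hne, h2, hv]; rfl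
  refine ⟨⟨?_, ?_⟩, ⟨?_, ?_⟩, ⟨?_, ?_⟩, ⟨?_, ?_⟩, ⟨?_, ?_⟩, ⟨?_, ?_⟩, ⟨?_, ?_⟩⟩
  · rw [bP, show (-1 : K) = ((-1 : ℤ) : K) by norm_num]; exact hint κpos (by decide)
  · rw [bN, show (-1 : K) = ((-1 : ℤ) : K) by norm_num]; exact hint κneg (by decide)
  · rw [bP, e1]; exact hu (by decide) (by decide)
  · rw [bN, e2]; exact hu (by decide) (by decide)
  · rw [bP, e3]; exact hhalf (by decide) (by decide)
  · rw [bN, e4]; exact hhalf (by decide) (by decide)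
  · rw [bP, show (2 : K) = ((2 : ℤ) : K) by norm_num]; exact hint κpos (by decide)
  · rw [bN, show (2 : K) = ((2 : ℤ) : K) by norm_num]; exact hint κneg (by decide)
  · rw [bP, show (3 : K) = ((3 : ℤ) : K) by norm_num]; exact hint κpos (by decide)
  · rw [bN, show (3 : K) = ((3 : ℤ) : K) by norm_num]; exact hint κneg (by decide)
  · rw [bP, e5]; exact hu (by decide) (by decide)
  · rw [bN, π₅K_eq, valuation_κneg_π₅]; rfl
  · rw [bP, map_ofNat, valuation_five']; rfl
  · rw [bN, map_ofNat, valuation_five']; rfl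

/-- Norms of the basis elements. [folklore] -/
theorem norm_values : (-1 : K).norm = 1 ∧ εK.norm = -1 ∧ π₂K.norm = 2 ∧ (2 : K).norm = 4 ∧
    (3 : K).norm = 9 ∧ π₅K.norm = -5 ∧ (5 : K).norm = 25 := by
  simp only [norm_def, εK, π₂K, π₅K]
  norm_num [re_ofNat, im_ofNat]

/-- `3`-parities of the basis elements: only `3` has `a₃ = 1`. [folklore] -/
theorem a3_values : a3 (-1 : K) = 0 ∧ a3 εK = 0 ∧ a3 π₂K = 0 ∧ a3 (2 : K) = 0 ∧ a3 (3 : K) = 1 ∧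
    a3 π₅K = 0 ∧ a3 (5 : K) = 0 := by
  haveI : Fact (Nat.Prime 3) := ⟨Nat.prime_three⟩
  obtain ⟨n1, n2, n3, n4, n5, n6, n7⟩ := norm_values
  have hv : ∀ {q : ℤ}, ¬ (3 : ℤ) ∣ q → padicValRat 3 (q : ℚ) = 0 := fun hq => by
    rw [padicValRat.of_int, padicValInt.eq_zero_of_not_dvd hq]; rfl
  simp only [a3_eq, n1, n2, n3, n4, n5, n6, n7]
  refine ⟨?_, ?_, ?_, ?_, ?_, ?_, ?_⟩
  · rw [padicValRat.one]; rfl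
  · rw [show (-1 : ℚ) = ((-1 : ℤ) : ℚ) by norm_num, hv (by decide)]; rfl
  · rw [show (2 : ℚ) = ((2 : ℤ) : ℚ) by norm_num, hv (by decide)]; rfl
  · rw [show (4 : ℚ) = ((4 : ℤ) : ℚ) by norm_num, hv (by decide)]; rfl
  · rw [show (9 : ℚ) = ((3 : ℕ) : ℚ) ^ 2 by norm_num, padicValRat.pow, padicValRat.self (by norm_num)]; rfl
  · rw [show (-5 : ℚ) = ((-5 : ℤ) : ℚ) by norm_num, hv (by decide)]; rfl
  · rw [show (25 : ℚ) = ((25 : ℤ) : ℚ) by norm_num, hv (by decide)]; rfl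

/-- **The bit table of the basis `-1, ε, π₂, 2, 3, π₅, 5` of `K(S, 2)`.** [folklore] -/
theorem Bits_values :
    Bits (-1 : K) = (1, 1, 0, 0, 0, 0, 0) ∧ Bits εK = (0, 1, 0, 0, 0, 0, 0) ∧
    Bits π₂K = (0, 0, 1, 0, 0, 0, 0) ∧ Bits (2 : K) = (0, 0, 1, 1, 0, 0, 0) ∧
    Bits (3 : K) = (0, 0, 0, 0, 1, 0, 0) ∧ Bits π₅K = (0, 1, 0, 0, 0, 0, 1) ∧
    Bits (5 : K) = (0, 0, 0, 0, 0, 1, 1) := by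
  obtain ⟨⟨s1, s1'⟩, ⟨s2, s2'⟩, ⟨s3, s3'⟩, ⟨s6, s6'⟩, sn⟩ := signs_values
  obtain ⟨⟨a1, a1'⟩, ⟨a2, a2'⟩, ⟨a3', a3''⟩, ⟨a4, a4'⟩, ⟨a5, a5'⟩, ⟨a6, a6'⟩, ⟨a7, a7'⟩⟩ := a_values
  obtain ⟨⟨b1, b1'⟩, ⟨b2, b2'⟩, ⟨b3, b3'⟩, ⟨b4, b4'⟩, ⟨b5, b5'⟩, ⟨b6, b6'⟩, ⟨b7, b7'⟩⟩ := b_values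
  obtain ⟨c1, c2, c3, c4, c5, c6, c7⟩ := a3_values
  obtain ⟨s4, s4'⟩ := sn 2
  obtain ⟨s5, s5'⟩ := sn 3
  obtain ⟨s7, s7'⟩ := sn 5
  simp only [Nat.cast_ofNat] at s4 s4' s5 s5' s7 s7'
  simp only [Bits, s1, s1', s2, s2', s3, s3', s4, s4', s5, s5', s6, s6', s7, s7', a1, a1', a2, a2', a3',
    a3'', a4, a4', a5, a5', a6, a6', a7, a7', b1, b1', b2, b2', b3, b3', b4, b4', b5, b5', b6, b6', b7, b7',
    c1, c2, c3, c4, c5, c6, c7, and_self]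

/-! ### The correction factor `∏ gⱼ^{nⱼ}` and the character sum -/

/-- A generator raised to a bit: `g^e` for `e ∈ ℤ/2` (`1` or `g`). [folklore] -/
def pw (g : K) (e : ZMod 2) : K := if e = 0 then 1 else g

/-- `pw g e ≠ 0`. [folklore] -/
theorem pw_ne_zero {g : K} (hg : g ≠ 0) (e : ZMod 2) : pw g e ≠ 0 := by
  unfold pw; split_ifs
  · exact one_ne_zero
  · exact hg

/-- The bits of `pw g e` are `e • Bits g`. [folklore] -/
theorem Bits_pw (g : K) (e : ZMod 2) : Bits (pw g e) = e • Bits g := by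
  unfold pw
  rcases (show e = 0 ∨ e = 1 by revert e; decide) with rfl | rfl
  · rw [if_pos rfl, zero_smul, Bits_one]
  · rw [if_neg (by decide), one_smul]

/-- **The exponents** of a class on the basis `-1, ε, π₂, 2, 3, π₅, 5` in terms of its bits
`B = (s⁺, s⁻, a⁺, a⁻, a₃, b⁺, b⁻)`:
`(s⁺, s⁺ + s⁻ + b⁺ + b⁻, a⁺ + a⁻, a⁻, a₃, b⁺ + b⁻, b⁺)` (the inverse of the bit table).
[folklore] -/
def ex (B : V7) : V7 :=
  (B.1, B.1 + B.2.1 + B.2.2.2.2.2.1 + B.2.2.2.2.2.2, B.2.2.1 + B.2.2.2.1, B.2.2.2.1, B.2.2.2.2.1,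
    B.2.2.2.2.2.1 + B.2.2.2.2.2.2, B.2.2.2.2.2.1)

/-- **The correction factor** `(-1)^{n₁} ε^{n₂} π₂^{n₃} 2^{n₄} 3^{n₅} π₅^{n₆} 5^{n₇}`. [folklore] -/
def corr (B : V7) : K :=
  pw (-1) (ex B).1 * pw εK (ex B).2.1 * pw π₂K (ex B).2.2.1 * pw 2 (ex B).2.2.2.1 *
    pw 3 (ex B).2.2.2.2.1 * pw π₅K (ex B).2.2.2.2.2.1 * pw 5 (ex B).2.2.2.2.2.2

/-- `corr B ≠ 0`. [folklore] -/
theorem corr_ne_zero (B : V7) : corr B ≠ 0 := by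
  obtain ⟨h1, h2, h3, h4, h5, h6, h7⟩ := gens_ne_zero
  unfold corr
  exact mul_ne_zero (mul_ne_zero (mul_ne_zero (mul_ne_zero (mul_ne_zero (mul_ne_zero
    (pw_ne_zero h1 _) (pw_ne_zero h2 _)) (pw_ne_zero h3 _)) (pw_ne_zero h4 _)) (pw_ne_zero h5 _))
    (pw_ne_zero h6 _)) (pw_ne_zero h7 _)

/-- **A bit additive on products, on `z · ∏ gⱼ^{nⱼ}`**: `f z + Σ nⱼ f gⱼ`. [folklore] -/
theorem bitlike_mul_corr (f : K → ZMod 2) (hf : ∀ {z w : K}, z ≠ 0 → w ≠ 0 → f (z * w) = f z + f w)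
    {z : K} (hz : z ≠ 0) (B : V7) :
    f (z * corr B) = f z + ((ex B).1 * f (-1) + (ex B).2.1 * f εK + (ex B).2.2.1 * f π₂K +
      (ex B).2.2.2.1 * f 2 + (ex B).2.2.2.2.1 * f 3 + (ex B).2.2.2.2.2.1 * f π₅K +
      (ex B).2.2.2.2.2.2 * f 5) := by
  obtain ⟨h1, h2, h3, h4, h5, h6, h7⟩ := gens_ne_zero
  have hf1 : f 1 = 0 := by
    have h := hf (one_ne_zero (α := K)) one_ne_zero
    rw [mul_one] at h
    have : f 1 + f 1 = 0 := CharTwo.add_self_eq_zero _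
    rwa [← h] at this
  have hpw : ∀ (g : K) (e : ZMod 2), f (pw g e) = e * f g := by
    intro g e
    unfold pw
    rcases (show e = 0 ∨ e = 1 by revert e; decide) with rfl | rfl
    · rw [if_pos rfl, zero_mul, hf1]
    · rw [if_neg (by decide), one_mul]
  unfold corr
  have p1 := pw_ne_zero h1 (ex B).1
  have p2 := pw_ne_zero h2 (ex B).2.1
  have p3 := pw_ne_zero h3 (ex B).2.2.1
  have p4 := pw_ne_zero h4 (ex B).2.2.2.1
  have p5 := pw_ne_zero h5 (ex B).2.2.2.2.1
  have p6 := pw_ne_zero h6 (ex B).2.2.2.2.2.1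
  have p7 := pw_ne_zero h7 (ex B).2.2.2.2.2.2
  rw [show z * (pw (-1) (ex B).1 * pw εK (ex B).2.1 * pw π₂K (ex B).2.2.1 * pw 2 (ex B).2.2.2.1 *
      pw 3 (ex B).2.2.2.2.1 * pw π₅K (ex B).2.2.2.2.2.1 * pw 5 (ex B).2.2.2.2.2.2) =
      z * pw (-1) (ex B).1 * pw εK (ex B).2.1 * pw π₂K (ex B).2.2.1 * pw 2 (ex B).2.2.2.1 *
      pw 3 (ex B).2.2.2.2.1 * pw π₅K (ex B).2.2.2.2.2.1 * pw 5 (ex B).2.2.2.2.2.2 by ring,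
    hf (mul_ne_zero (mul_ne_zero (mul_ne_zero (mul_ne_zero (mul_ne_zero (mul_ne_zero hz p1) p2) p3)
      p4) p5) p6) p7,
    hf (mul_ne_zero (mul_ne_zero (mul_ne_zero (mul_ne_zero (mul_ne_zero hz p1) p2) p3) p4) p5) p6,
    hf (mul_ne_zero (mul_ne_zero (mul_ne_zero (mul_ne_zero hz p1) p2) p3) p4) p5,
    hf (mul_ne_zero (mul_ne_zero (mul_ne_zero hz p1) p2) p3) p4,
    hf (mul_ne_zero (mul_ne_zero hz p1) p2) p3, hf (mul_ne_zero hz p1) p2, hf hz p1,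
    hpw, hpw, hpw, hpw, hpw, hpw, hpw]
  ring

/-- The bits of `z · ∏ gⱼ^{nⱼ}`. [folklore] -/
theorem Bits_mul_corr {z : K} (hz : z ≠ 0) (B : V7) :
    Bits (z * corr B) = Bits z + ((ex B).1 • Bits (-1 : K) + (ex B).2.1 • Bits εK +
      (ex B).2.2.1 • Bits π₂K + (ex B).2.2.2.1 • Bits (2 : K) + (ex B).2.2.2.2.1 • Bits (3 : K) +
      (ex B).2.2.2.2.2.1 • Bits π₅K + (ex B).2.2.2.2.2.2 • Bits (5 : K)) := by
  obtain ⟨h1, h2, h3, h4, h5, h6, h7⟩ := gens_ne_zero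
  unfold corr
  have p1 := pw_ne_zero h1 (ex B).1
  have p2 := pw_ne_zero h2 (ex B).2.1
  have p3 := pw_ne_zero h3 (ex B).2.2.1
  have p4 := pw_ne_zero h4 (ex B).2.2.2.1
  have p5 := pw_ne_zero h5 (ex B).2.2.2.2.1
  have p6 := pw_ne_zero h6 (ex B).2.2.2.2.2.1
  have p7 := pw_ne_zero h7 (ex B).2.2.2.2.2.2
  rw [show z * (pw (-1) (ex B).1 * pw εK (ex B).2.1 * pw π₂K (ex B).2.2.1 * pw 2 (ex B).2.2.2.1 *
      pw 3 (ex B).2.2.2.2.1 * pw π₅K (ex B).2.2.2.2.2.1 * pw 5 (ex B).2.2.2.2.2.2) =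
      z * pw (-1) (ex B).1 * pw εK (ex B).2.1 * pw π₂K (ex B).2.2.1 * pw 2 (ex B).2.2.2.1 *
      pw 3 (ex B).2.2.2.2.1 * pw π₅K (ex B).2.2.2.2.2.1 * pw 5 (ex B).2.2.2.2.2.2 by ring,
    Bits_mul (mul_ne_zero (mul_ne_zero (mul_ne_zero (mul_ne_zero (mul_ne_zero (mul_ne_zero hz p1) p2) p3)
      p4) p5) p6) p7,
    Bits_mul (mul_ne_zero (mul_ne_zero (mul_ne_zero (mul_ne_zero (mul_ne_zero hz p1) p2) p3) p4) p5) p6,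
    Bits_mul (mul_ne_zero (mul_ne_zero (mul_ne_zero (mul_ne_zero hz p1) p2) p3) p4) p5,
    Bits_mul (mul_ne_zero (mul_ne_zero (mul_ne_zero hz p1) p2) p3) p4,
    Bits_mul (mul_ne_zero (mul_ne_zero hz p1) p2) p3, Bits_mul (mul_ne_zero hz p1) p2, Bits_mul hz p1,
    Bits_pw, Bits_pw, Bits_pw, Bits_pw, Bits_pw, Bits_pw, Bits_pw]
  abel

set_option maxRecDepth 100000 in
/-- The exponents invert the bit table: `B + Σⱼ nⱼ(B) Bits(gⱼ) = 0` for all `B ∈ 𝔽₂⁷`. [folklore] -/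
theorem ex_key : ∀ B : V7, B + ((ex B).1 • ((1, 1, 0, 0, 0, 0, 0) : V7) +
    (ex B).2.1 • ((0, 1, 0, 0, 0, 0, 0) : V7) + (ex B).2.2.1 • ((0, 0, 1, 0, 0, 0, 0) : V7) +
    (ex B).2.2.2.1 • ((0, 0, 1, 1, 0, 0, 0) : V7) + (ex B).2.2.2.2.1 • ((0, 0, 0, 0, 1, 0, 0) : V7) +
    (ex B).2.2.2.2.2.1 • ((0, 1, 0, 0, 0, 0, 1) : V7) + (ex B).2.2.2.2.2.2 • ((0, 0, 0, 0, 0, 1, 1) : V7)) = 0 := by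
  decide

/-- **All structural bits of `z · ∏ gⱼ^{nⱼ(Bits z)}` vanish.** [folklore] -/
theorem Bits_mul_corr_eq_zero {z : K} (hz : z ≠ 0) : Bits (z * corr (Bits z)) = 0 := by
  obtain ⟨b1, b2, b3, b4, b5, b6, b7⟩ := Bits_values
  rw [Bits_mul_corr hz, b1, b2, b3, b4, b5, b6, b7]
  exact ex_key (Bits z)

/-! ### Valuations of the basis outside `S` -/

/-- If `r s = 30` in `𝓞 K` and `30 ∉ v`, then `ord_v(r) = 0`. [folklore] -/
theorem valuation_eq_one_of_mul_eq {r t : 𝓞 K} (h : r * t = 30) (v : HeightOneSpectrum (𝓞 K))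
    (hv : (30 : 𝓞 K) ∉ v.asIdeal) : v.valuation K (r : K) = 1 := by
  have h30 : v.intValuation (30 : 𝓞 K) = 1 := intValuation_eq_one_iff.mpr hv
  rw [← h, map_mul] at h30
  have hr := v.intValuation_le_one r
  have ht := v.intValuation_le_one t
  rw [RingOfIntegers.coe_eq_algebraMap, valuation_of_algebraMap]
  by_contra hne
  have hlt : v.intValuation r < 1 := lt_of_le_of_ne hr hne
  have : v.intValuation r * v.intValuation t < 1 := by
    calc v.intValuation r * v.intValuation t ≤ v.intValuation r * 1 := by gcongr
      _ < 1 := by rwa [mul_one]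
  exact absurd h30 this.ne

/-- **The basis elements are units outside `S`**: `ord_v(g) = 0` for `30 ∉ v`. [folklore] -/
theorem valuation_gens (v : HeightOneSpectrum (𝓞 K)) (hv : (30 : 𝓞 K) ∉ v.asIdeal) :
    v.valuation K (-1) = 1 ∧ v.valuation K εK = 1 ∧ v.valuation K π₂K = 1 ∧ v.valuation K 2 = 1 ∧
    v.valuation K 3 = 1 ∧ v.valuation K π₅K = 1 ∧ v.valuation K 5 = 1 := by
  refine ⟨by rw [Valuation.map_neg, Valuation.map_one], ?_, ?_, ?_, ?_, ?_, ?_⟩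
  · rw [εK_eq, RingOfIntegers.coe_eq_algebraMap, valuation_of_algebraMap]
    exact intValuation_eq_one_iff.mpr fun h =>
      v.isPrime.ne_top (Ideal.eq_top_of_isUnit_mem _ h (Units.isUnit unitEps))
  · rw [π₂K_eq]
    exact valuation_eq_one_of_mul_eq (t := π₂' * 15) (by rw [← mul_assoc, π₂_mul_π₂']; norm_num) v hv
  · have := valuation_eq_one_of_mul_eq (r := 2) (t := 15) (by norm_num) v hv
    simpa [map_ofNat] using this
  · have := valuation_eq_one_of_mul_eq (r := 3) (t := 10) (by norm_num) v hv
    simpa [map_ofNat] using this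
  · rw [π₅K_eq]
    exact valuation_eq_one_of_mul_eq (t := π₅' * 6) (by rw [← mul_assoc, π₅_mul_π₅']; norm_num) v hv
  · have := valuation_eq_one_of_mul_eq (r := 5) (t := 6) (by norm_num) v hv
    simpa [map_ofNat] using this

/-- `ord_v(pw g e)` is trivial outside `S`. [folklore] -/
theorem valuation_pw {g : K} {v : HeightOneSpectrum (𝓞 K)} (hg : v.valuation K g = 1) (e : ZMod 2) :
    v.valuation K (pw g e) = 1 := by
  unfold pw; split_ifs
  · exact Valuation.map_one _
  · exact hg

/-- `ord_v(∏ gⱼ^{nⱼ}) = 0` outside `S`. [folklore] -/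
theorem valuation_corr (B : V7) (v : HeightOneSpectrum (𝓞 K)) (hv : (30 : 𝓞 K) ∉ v.asIdeal) :
    v.valuation K (corr B) = 1 := by
  obtain ⟨g1, g2, g3, g4, g5, g6, g7⟩ := valuation_gens v hv
  unfold corr
  simp only [Valuation.map_mul, valuation_pw g1, valuation_pw g2, valuation_pw g3, valuation_pw g4,
    valuation_pw g5, valuation_pw g6, valuation_pw g7, mul_one]

/-! ### The character sum -/

/-- **`z · ∏ gⱼ^{nⱼ(Bits z)}` is a square** for `z ∈ Kˣ` with even valuation outside `S`: all its
structural bits vanish (`Bits_mul_corr_eq_zero`), so the square theorem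
`Sqrt41.exists_sq_eq_of_local_data` applies. This is `K(S, 2) ≅ 𝔽₂⁷` with basis
`-1, ε, π₂, 2, 3, π₅, 5`. [cite: SilvermanAEC2009, Prop. VIII.1.6] -/
theorem exists_sq_eq_mul_corr {z : K} (hz : z ≠ 0)
    (hS : ∀ v : HeightOneSpectrum (𝓞 K), (30 : 𝓞 K) ∉ v.asIdeal → (2 : ℤ) ∣ log (v.valuation K z)) :
    ∃ w : K, z * corr (Bits z) = w ^ 2 := by
  haveI : Fact (Nat.Prime 3) := ⟨Nat.prime_three⟩
  set z' := z * corr (Bits z) with hz'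
  have hz'0 : z' ≠ 0 := mul_ne_zero hz (corr_ne_zero _)
  have hB := Bits_mul_corr_eq_zero hz
  rw [← hz'] at hB
  simp only [Bits, Prod.mk_eq_zero] at hB
  obtain ⟨hs1, hs2, ha1, ha2, ha3, hb1, hb2⟩ := hB
  have hev : ∀ {n : ℤ}, (n : ZMod 2) = 0 → Even n := fun h =>
    even_iff_two_dvd.mpr ((ZMod.intCast_zmod_eq_zero_iff_dvd _ 2).mp h)
  refine exists_sq_eq_of_local_data hz'0 (fun v hv => ?_) (hev ha1) (hev ha2) ?_ (hev hb1) (hev hb2)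
    ((rsign_eq_zero_iff ((map_ne_zero σpos).mpr hz'0)).mp hs1)
    ((rsign_eq_zero_iff ((map_ne_zero σneg).mpr hz'0)).mp hs2)
  · have hvz : v.valuation K z ≠ 0 := (Valuation.ne_zero_iff _).mpr hz
    have hvc : v.valuation K (corr (Bits z)) ≠ 0 := (Valuation.ne_zero_iff _).mpr (corr_ne_zero _)
    rw [hz', Valuation.map_mul, log_mul hvz hvc, valuation_corr _ v hv, log_one, add_zero]
    exact hS v hv
  · have h4 := (inertPlace_parity_eq_zero_iff 3 41 inert_three_data.1 inert_three_data.2 hz'0).mp ha3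
    rwa [algNorm_eq_norm]

/-- The value of a character of `Kˣ/Kˣ²` on (the class of) an element. [folklore] -/
def cv (c : Additive (SqUnits K) →+ ZMod 2) (z : K) : ZMod 2 := c (Additive.ofMul (sqClass z))

/-- `cv c` is additive on products of non-zero elements. [folklore] -/
theorem cv_mul (c : Additive (SqUnits K) →+ ZMod 2) {z w : K} (hz : z ≠ 0) (hw : w ≠ 0) :
    cv c (z * w) = cv c z + cv c w := by
  rw [cv, cv, cv, sqClass_mul hz hw, ofMul_mul, map_add]

/-- `cv c` kills squares. [folklore] -/
theorem cv_sq (c : Additive (SqUnits K) →+ ZMod 2) (w : K) : cv c (w ^ 2) = 0 := by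
  rw [cv, sqClass_sq, ofMul_one, map_zero]

/-- **The character sum for `K = ℚ(√41)`, `S = {∞±, 2±, 3, 5±}`.** For every character `c` of
`Kˣ/Kˣ²` and every `z ∈ Kˣ` with even valuation at all primes not above `30`:
`c[z] = n₁ c[-1] + n₂ c[ε] + n₃ c[π₂] + n₄ c[2] + n₅ c[3] + n₆ c[π₅] + n₇ c[5]` with
`(n₁, …, n₇) = ex (Bits z)` — the analogue over `K` of the tree's `char_sqClass_eq_sum` over `ℚ`
(unique factorisation being replaced by `h_K = 1` and the unit theorem).
[cite: SilvermanAEC2009, Prop. VIII.1.6] -/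
theorem char_eq_sum (c : Additive (SqUnits K) →+ ZMod 2) {z : K} (hz : z ≠ 0)
    (hS : ∀ v : HeightOneSpectrum (𝓞 K), (30 : 𝓞 K) ∉ v.asIdeal → (2 : ℤ) ∣ log (v.valuation K z)) :
    cv c z = (ex (Bits z)).1 * cv c (-1) + (ex (Bits z)).2.1 * cv c εK + (ex (Bits z)).2.2.1 * cv c π₂K +
      (ex (Bits z)).2.2.2.1 * cv c 2 + (ex (Bits z)).2.2.2.2.1 * cv c 3 +
      (ex (Bits z)).2.2.2.2.2.1 * cv c π₅K + (ex (Bits z)).2.2.2.2.2.2 * cv c 5 := by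
  obtain ⟨w, hw⟩ := exists_sq_eq_mul_corr hz hS
  have h := bitlike_mul_corr (cv c) (fun hz hw => cv_mul c hz hw) hz (Bits z)
  rw [hw, cv_sq] at h
  have key : ∀ a b : ZMod 2, 0 = a + b → a = b := by decide
  exact key _ _ h

/-! ### The seven local characters and their values on the basis -/

/-- `c4⁺ = chi4 ∘ ι⁺` (odd part of `ι⁺ z` is `3 mod 4`). [folklore] -/
def c4P (z : K) : ZMod 2 := pc4 (ιpos z)
/-- `c8⁺ = chi8 ∘ ι⁺`. [folklore] -/
def c8P (z : K) : ZMod 2 := pc8 (ιpos z)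
/-- `c4⁻ = chi4 ∘ ι⁻`. [folklore] -/
def c4N (z : K) : ZMod 2 := pc4 (ιneg z)
/-- `c8⁻ = chi8 ∘ ι⁻`. [folklore] -/
def c8N (z : K) : ZMod 2 := pc8 (ιneg z)
/-- `x₃`: the quadratic character of the residue field `𝔽₉` at `(3)`, via the norm. [folklore] -/
def x3 (z : K) : ZMod 2 := 𝔳3.χ z
/-- `q⁺`: the Legendre bit mod `5` under `κ⁺` (the place `𝔭₅'`). [folklore] -/
def qP (z : K) : ZMod 2 := pχ 5 (κpos z)
/-- `q⁻`: the Legendre bit mod `5` under `κ⁻` (the place `𝔭₅`). [folklore] -/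
def qN (z : K) : ZMod 2 := pχ 5 (κneg z)

/-- Unfolding `x3`: `qrBit 3 (N z)`. [folklore] -/
theorem x3_eq (z : K) : x3 z = qrBit 3 z.norm := rfl

/-- The seven local characters are additive on products (stated for `chars_mul`). [folklore] -/
theorem chars_mul {z w : K} (hz : z ≠ 0) (hw : w ≠ 0) :
    c4P (z * w) = c4P z + c4P w ∧ c8P (z * w) = c8P z + c8P w ∧ c4N (z * w) = c4N z + c4N w ∧
    c8N (z * w) = c8N z + c8N w ∧ x3 (z * w) = x3 z + x3 w ∧ qP (z * w) = qP z + qP w ∧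
    qN (z * w) = qN z + qN w := by
  have i1 := (map_ne_zero ιpos).mpr hz; have i2 := (map_ne_zero ιpos).mpr hw
  have j1 := (map_ne_zero ιneg).mpr hz; have j2 := (map_ne_zero ιneg).mpr hw
  have k1 := (map_ne_zero κpos).mpr hz; have k2 := (map_ne_zero κpos).mpr hw
  have l1 := (map_ne_zero κneg).mpr hz; have l2 := (map_ne_zero κneg).mpr hw
  refine ⟨?_, ?_, ?_, ?_, 𝔳3.χ_mul hz hw, ?_, ?_⟩
  · rw [c4P, c4P, c4P, map_mul, pc4_mul i1 i2]
  · rw [c8P, c8P, c8P, map_mul, pc8_mul i1 i2]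
  · rw [c4N, c4N, c4N, map_mul, pc4_mul j1 j2]
  · rw [c8N, c8N, c8N, map_mul, pc8_mul j1 j2]
  · rw [qP, qP, qP, map_mul, pχ_mul 5 k1 k2]
  · rw [qN, qN, qN, map_mul, pχ_mul 5 l1 l2]

/-- **The row of local character values** `(c4⁺, c8⁺, c4⁻, c8⁻, x₃, q⁺, q⁻)` of `z`. [folklore] -/
def Row (z : K) : V7 := (c4P z, c8P z, c4N z, c8N z, x3 z, qP z, qN z)

/-- `pc4`, `pc8` of `n + m t` (`n` odd, `8 ∣ m`). [folklore] -/
theorem pc48_intCast_add_mul {n m : ℤ} (hn : ¬ (2 : ℤ) ∣ n) (hm : (8 : ℤ) ∣ m) (t : ℤ_[2]) :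
    pc4 ((n : ℚ_[2]) + (m : ℚ_[2]) * (t : ℚ_[2])) = chi4Of (n : ZMod (2 ^ 3)) ∧
    pc8 ((n : ℚ_[2]) + (m : ℚ_[2]) * (t : ℚ_[2])) = chi8Of (n : ZMod (2 ^ 3)) := by
  have h := presPow_intCast_add_mul 3 hn (by exact_mod_cast hm) (dvd_trans (by norm_num) hm) t
  exact ⟨by rw [pc4, pres8, h], by rw [pc8, pres8, h]⟩

/-- `pχ 5 t = 1` if the residue is a non-square. [folklore] -/
theorem pχ_eq_one_of_not_isSquare {t : ℚ_[5]} (h : ¬ IsSquare (pres 5 t)) : pχ 5 t = 1 := by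
  have hne : pχ 5 t ≠ 0 := fun h0 => h ((pχ_eq_zero_iff 5 t).mp h0)
  revert hne; generalize pχ 5 t = b; revert b; decide

/-- `pχ 5 t = 0` if the residue is a square. [folklore] -/
theorem pχ_eq_zero_of_isSquare {t : ℚ_[5]} (h : IsSquare (pres 5 t)) : pχ 5 t = 0 :=
  (pχ_eq_zero_iff 5 t).mpr h

/-- Squares and non-squares in `𝔽₅` among the residues met. [folklore] -/
theorem isSquare_five :
    ¬ IsSquare ((137 : ℤ) : ZMod 5) ∧ ¬ IsSquare ((-73 : ℤ) : ZMod 5) ∧ ¬ IsSquare ((28 : ℤ) : ZMod 5) ∧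
    IsSquare ((-14 : ℤ) : ZMod 5) ∧ ¬ IsSquare ((27 : ℤ) : ZMod 5) ∧ ¬ IsSquare ((-3 : ℤ) : ZMod 5) := by
  obtain ⟨-, n2, n3, -, -, s1⟩ := isSquare_values
  refine ⟨?_, ?_, ?_, ?_, ?_, ?_⟩
  · rw [show ((137 : ℤ) : ZMod 5) = 2 by decide]; exact n2
  · rw [show ((-73 : ℤ) : ZMod 5) = 2 by decide]; exact n2
  · rw [show ((28 : ℤ) : ZMod 5) = 3 by decide]; exact n3
  · rw [show ((-14 : ℤ) : ZMod 5) = 1 by decide]; exact s1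
  · rw [show ((27 : ℤ) : ZMod 5) = 2 by decide]; exact n2
  · rw [show ((-3 : ℤ) : ZMod 5) = 2 by decide]; exact n2

/-- The `2`-adic characters on the rational basis elements `-1, 2, 3, 5` (tree tables). [folklore] -/
theorem c_values_rat :
    (c4P (-1 : K) = 1 ∧ c8P (-1 : K) = 0 ∧ c4N (-1 : K) = 1 ∧ c8N (-1 : K) = 0) ∧
    (c4P (2 : K) = 0 ∧ c8P (2 : K) = 0 ∧ c4N (2 : K) = 0 ∧ c8N (2 : K) = 0) ∧
    (c4P (3 : K) = 1 ∧ c8P (3 : K) = 1 ∧ c4N (3 : K) = 1 ∧ c8N (3 : K) = 1) ∧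
    (c4P (5 : K) = 0 ∧ c8P (5 : K) = 1 ∧ c4N (5 : K) = 0 ∧ c8N (5 : K) = 1) := by
  obtain ⟨f1, f2, f3, f5, -, -⟩ := chi4_values
  obtain ⟨e1, e2, e3, e5, -, -⟩ := chi8_values
  have hm : ∀ (τ : K →ₐ[ℚ] ℚ_[2]), τ (-1 : K) = ((-1 : ℚ) : ℚ_[2]) ∧ τ (2 : K) = ((2 : ℚ) : ℚ_[2]) ∧
      τ (3 : K) = ((3 : ℚ) : ℚ_[2]) ∧ τ (5 : K) = ((5 : ℚ) : ℚ_[2]) := fun τ =>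
    ⟨by rw [map_neg, map_one]; norm_num, by rw [map_ofNat]; norm_num, by rw [map_ofNat]; norm_num,
      by rw [map_ofNat]; norm_num⟩
  obtain ⟨p1, p2, p3, p5⟩ := hm ιpos
  obtain ⟨n1, n2, n3, n5⟩ := hm ιneg
  simp only [c4P, c8P, c4N, c8N, p1, p2, p3, p5, n1, n2, n3, n5, pc4_ratCast, pc8_ratCast, f1, f2, f3, f5,
    e1, e2, e3, e5, and_self]

/-- The `5`-adic characters on the rational basis elements (tree tables). [folklore] -/
theorem q_values_rat :
    (qP (-1 : K) = 0 ∧ qN (-1 : K) = 0) ∧ (qP (2 : K) = 1 ∧ qN (2 : K) = 1) ∧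
    (qP (3 : K) = 1 ∧ qN (3 : K) = 1) ∧ (qP (5 : K) = 0 ∧ qN (5 : K) = 0) := by
  obtain ⟨g1, g2, g3, g5, -, -⟩ := qrBit_five_values
  have hm : ∀ (τ : K →ₐ[ℚ] ℚ_[5]), τ (-1 : K) = ((-1 : ℚ) : ℚ_[5]) ∧ τ (2 : K) = ((2 : ℚ) : ℚ_[5]) ∧
      τ (3 : K) = ((3 : ℚ) : ℚ_[5]) ∧ τ (5 : K) = ((5 : ℚ) : ℚ_[5]) := fun τ =>
    ⟨by rw [map_neg, map_one]; norm_num, by rw [map_ofNat]; norm_num, by rw [map_ofNat]; norm_num,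
      by rw [map_ofNat]; norm_num⟩
  obtain ⟨p1, p2, p3, p5⟩ := hm κpos
  obtain ⟨n1, n2, n3, n5⟩ := hm κneg
  simp only [qP, qN, p1, p2, p3, p5, n1, n2, n3, n5, pχ_ratCast, g1, g2, g3, g5, and_self]

/-- `x₃` on the basis: `1` on `ε`, `π₂` (norms `-1`, `2` are non-squares mod `3`), else `0`.
[folklore] -/
theorem x3_values : x3 (-1 : K) = 0 ∧ x3 εK = 1 ∧ x3 π₂K = 1 ∧ x3 (2 : K) = 0 ∧ x3 (3 : K) = 0 ∧
    x3 π₅K = 0 ∧ x3 (5 : K) = 0 := by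
  haveI : Fact (Nat.Prime 3) := ⟨Nat.prime_three⟩
  obtain ⟨n1, n2, n3, n4, n5, n6, n7⟩ := norm_values
  obtain ⟨t1, t2, t3, t5, -, -⟩ := qrBit_three_values
  simp only [x3_eq, n1, n2, n3, n4, n5, n6, n7]
  refine ⟨?_, t1, t2, ?_, ?_, ?_, ?_⟩
  · rw [show (1 : ℚ) = 1 ^ 2 by norm_num, qrBit_sq]
  · rw [show (4 : ℚ) = 2 ^ 2 by norm_num, qrBit_sq]
  · rw [show (9 : ℚ) = 3 ^ 2 by norm_num, qrBit_sq]
  · rw [show (-5 : ℚ) = (-1) * 5 by norm_num, qrBit_mul 3 (by norm_num) (by norm_num), t1, t5]; decide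
  · rw [show (25 : ℚ) = 5 ^ 2 by norm_num, qrBit_sq]

/-- The `2`-adic characters on `ε, π₂, π₅`: residues `97, -33; 2·5, -3; 19, -7` mod `8`.
[folklore] -/
theorem c_values_irrat :
    (c4P εK = 0 ∧ c8P εK = 0 ∧ c4N εK = 1 ∧ c8N εK = 0) ∧
    (c4P π₂K = 0 ∧ c8P π₂K = 1 ∧ c4N π₂K = 0 ∧ c8N π₂K = 1) ∧
    (c4P π₅K = 1 ∧ c8P π₅K = 1 ∧ c4N π₅K = 0 ∧ c8N π₅K = 0) := by
  obtain ⟨t, ht⟩ := exists_sqrt41Two_eq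
  obtain ⟨e1, e2, e3, e4, e5, e6⟩ := ι_values ht
  obtain ⟨a1, b1⟩ := pc48_intCast_add_mul (n := 97) (m := 320) (by decide) (by decide) t
  obtain ⟨a2, b2⟩ := pc48_intCast_add_mul (n := -33) (m := -320) (by decide) (by decide) t
  obtain ⟨a3, b3⟩ := pc48_intCast_add_mul (n := 5) (m := 16) (by decide) (by decide) t
  obtain ⟨a4, b4⟩ := pc48_intCast_add_mul (n := -3) (m := -32) (by decide) (by decide) t
  obtain ⟨a5, b5⟩ := pc48_intCast_add_mul (n := 19) (m := 64) (by decide) (by decide) t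
  obtain ⟨a6, b6⟩ := pc48_intCast_add_mul (n := -7) (m := -64) (by decide) (by decide) t
  have hu := (valuation_intCast_add_mul (p := 2) (n := 5) (m := 16) (by decide) (by decide) t).1
  have h2 : pc4 (2 : ℚ_[2]) = 0 ∧ pc8 (2 : ℚ_[2]) = 0 := by
    rw [show (2 : ℚ_[2]) = ((2 : ℚ) : ℚ_[2]) by norm_num, pc4_ratCast, pc8_ratCast]
    exact ⟨chi4_values.2.1, chi8_values.2.1⟩
  refine ⟨⟨?_, ?_, ?_, ?_⟩, ⟨?_, ?_, ?_, ?_⟩, ⟨?_, ?_, ?_, ?_⟩⟩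
  · rw [c4P, e1, a1]; decide
  · rw [c8P, e1, b1]; decide
  · rw [c4N, e2, a2]; decide
  · rw [c8N, e2, b2]; decide
  · rw [c4P, e3, pc4_mul two_ne_zero hu, h2.1, a3]; decide
  · rw [c8P, e3, pc8_mul two_ne_zero hu, h2.2, b3]; decide
  · rw [c4N, e4, a4]; decide
  · rw [c8N, e4, b4]; decide
  · rw [c4P, e5, a5]; decide
  · rw [c8P, e5, b5]; decide
  · rw [c4N, e6, a6]; decide
  · rw [c8N, e6, b6]; decide

/-- The `5`-adic characters on `ε, π₂, π₅`: residues `137, -73; 2⁻¹·28, 2⁻¹·(-14); 27, 5·(-3)`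
mod `5`. [folklore] -/
theorem q_values_irrat :
    (qP εK = 1 ∧ qN εK = 1) ∧ (qP π₂K = 0 ∧ qN π₂K = 1) ∧ (qP π₅K = 1 ∧ qN π₅K = 1) := by
  obtain ⟨t, ht⟩ := exists_sqrt41Five_eq
  obtain ⟨e1, e2, e3, e4, e5, e6⟩ := κ_values ht
  obtain ⟨s1, s2, s3, s4, s5, s6⟩ := isSquare_five
  have r1 := pres_intCast_add_mul (p := 5) (n := 137) (m := 125) (by decide) (by decide) t
  have r2 := pres_intCast_add_mul (p := 5) (n := -73) (m := -125) (by decide) (by decide) t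
  have r3 := pres_intCast_add_mul (p := 5) (n := 28) (m := 25) (by decide) (by decide) t
  have r4 := pres_intCast_add_mul (p := 5) (n := -14) (m := -25) (by decide) (by decide) t
  have r5 := pres_intCast_add_mul (p := 5) (n := 27) (m := 25) (by decide) (by decide) t
  have r6 := pres_intCast_add_mul (p := 5) (n := -3) (m := -5) (by decide) (by decide) t
  have u3 := (valuation_intCast_add_mul (p := 5) (n := 28) (m := 25) (by decide) (by decide) t).1
  have u4 := (valuation_intCast_add_mul (p := 5) (n := -14) (m := -25) (by decide) (by decide) t).1
  have u6 := (valuation_intCast_add_mul (p := 5) (n := -3) (m := -5) (by decide) (by decide) t).1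
  have h2 : pχ 5 (2 : ℚ_[5])⁻¹ = 1 := by
    have := (padicPlace 5).χ_inv (two_ne_zero (α := ℚ_[5]))
    rw [padicPlace_χ, padicPlace_χ] at this
    rw [this, show (2 : ℚ_[5]) = ((2 : ℚ) : ℚ_[5]) by norm_num, pχ_ratCast]
    exact qrBit_five_values.2.1
  have h5 : pχ 5 (5 : ℚ_[5]) = 0 := by
    rw [show (5 : ℚ_[5]) = ((5 : ℚ) : ℚ_[5]) by norm_num, pχ_ratCast]
    exact qrBit_five_values.2.2.2.1
  refine ⟨⟨?_, ?_⟩, ⟨?_, ?_⟩, ⟨?_, ?_⟩⟩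
  · rw [qP, e1]; exact pχ_eq_one_of_not_isSquare (by rw [r1]; exact s1)
  · rw [qN, e2]; exact pχ_eq_one_of_not_isSquare (by rw [r2]; exact s2)
  · rw [qP, e3, pχ_mul 5 (inv_ne_zero two_ne_zero) u3, h2, pχ_eq_one_of_not_isSquare (by rw [r3]; exact s3)]
    decide
  · rw [qN, e4, pχ_mul 5 (inv_ne_zero two_ne_zero) u4, h2, pχ_eq_zero_of_isSquare (by rw [r4]; exact s4)]
    decide
  · rw [qP, e5]; exact pχ_eq_one_of_not_isSquare (by rw [r5]; exact s5)
  · rw [qN, e6, pχ_mul 5 (by norm_num) u6, h5, pχ_eq_one_of_not_isSquare (by rw [r6]; exact s6)]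
    decide

/-- **The table of local character values on the basis of `K(S, 2)`** (rows
`(c4⁺, c8⁺, c4⁻, c8⁻, x₃, q⁺, q⁻)`). [folklore] -/
theorem Row_values :
    Row (-1 : K) = (1, 0, 1, 0, 0, 0, 0) ∧ Row εK = (0, 0, 1, 0, 1, 1, 1) ∧
    Row π₂K = (0, 1, 0, 1, 1, 0, 1) ∧ Row (2 : K) = (0, 0, 0, 0, 0, 1, 1) ∧
    Row (3 : K) = (1, 1, 1, 1, 0, 1, 1) ∧ Row π₅K = (1, 1, 0, 0, 0, 1, 1) ∧
    Row (5 : K) = (0, 1, 0, 1, 0, 0, 0) := by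
  obtain ⟨⟨a1, a2, a3, a4⟩, ⟨b1, b2, b3, b4⟩, ⟨d1, d2, d3, d4⟩, ⟨f1, f2, f3, f4⟩⟩ := c_values_rat
  obtain ⟨⟨g1, g2⟩, ⟨g3, g4⟩, ⟨g5, g6⟩, ⟨g7, g8⟩⟩ := q_values_rat
  obtain ⟨x1, x2, x3', x4, x5, x6, x7⟩ := x3_values
  obtain ⟨⟨h1, h2, h3, h4⟩, ⟨i1, i2, i3, i4⟩, ⟨j1, j2, j3, j4⟩⟩ := c_values_irrat
  obtain ⟨⟨k1, k2⟩, ⟨k3, k4⟩, ⟨k5, k6⟩⟩ := q_values_irrat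
  simp only [Row, a1, a2, a3, a4, b1, b2, b3, b4, d1, d2, d3, d4, f1, f2, f3, f4, g1, g2, g3, g4, g5, g6,
    g7, g8, x1, x2, x3', x4, x5, x6, x7, h1, h2, h3, h4, i1, i2, i3, i4, j1, j2, j3, j4, k1, k2, k3, k4,
    k5, k6, and_self]

/-- A local character as a homomorphism on `Kˣ/Kˣ²` and its character sum. For `f` one of the
seven local characters (each additive on products of non-zero elements), and `z ∈ Kˣ` with even
valuation outside `S`: `f z = Σⱼ nⱼ(Bits z) f(gⱼ)`. [cite: SilvermanAEC2009, Prop. VIII.1.6] -/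
theorem bit_eq_sum (f : K → ZMod 2) (hf : ∀ {z w : K}, z ≠ 0 → w ≠ 0 → f (z * w) = f z + f w)
    {z : K} (hz : z ≠ 0)
    (hS : ∀ v : HeightOneSpectrum (𝓞 K), (30 : 𝓞 K) ∉ v.asIdeal → (2 : ℤ) ∣ log (v.valuation K z)) :
    f z = (ex (Bits z)).1 * f (-1) + (ex (Bits z)).2.1 * f εK + (ex (Bits z)).2.2.1 * f π₂K +
      (ex (Bits z)).2.2.2.1 * f 2 + (ex (Bits z)).2.2.2.2.1 * f 3 +
      (ex (Bits z)).2.2.2.2.2.1 * f π₅K + (ex (Bits z)).2.2.2.2.2.2 * f 5 := by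
  have h := char_eq_sum (bitHom f (fun ha hb => hf ha hb)) hz hS
  obtain ⟨-, h2, h3, -, -, h6, -⟩ := gens_ne_zero
  simp only [cv, bitHom_sqClass _ _ hz, bitHom_sqClass _ _ (show (-1 : K) ≠ 0 by norm_num),
    bitHom_sqClass _ _ h2, bitHom_sqClass _ _ h3, bitHom_sqClass _ _ (show (2 : K) ≠ 0 by norm_num),
    bitHom_sqClass _ _ (show (3 : K) ≠ 0 by norm_num), bitHom_sqClass _ _ h6,
    bitHom_sqClass _ _ (show (5 : K) ≠ 0 by norm_num)] at h
  exact h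

/-- **The local characters in coordinates.** For `z ∈ Kˣ` with even valuation outside `S`,
`Row z` is the `𝔽₂`-linear image of `Bits z` through the exponents and the value table.
[folklore] -/
theorem Row_eq (z : K) (hz : z ≠ 0)
    (hS : ∀ v : HeightOneSpectrum (𝓞 K), (30 : 𝓞 K) ∉ v.asIdeal → (2 : ℤ) ∣ log (v.valuation K z)) :
    Row z = (ex (Bits z)).1 • ((1, 0, 1, 0, 0, 0, 0) : V7) + (ex (Bits z)).2.1 • ((0, 0, 1, 0, 1, 1, 1) : V7) +
      (ex (Bits z)).2.2.1 • ((0, 1, 0, 1, 1, 0, 1) : V7) + (ex (Bits z)).2.2.2.1 • ((0, 0, 0, 0, 0, 1, 1) : V7) +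
      (ex (Bits z)).2.2.2.2.1 • ((1, 1, 1, 1, 0, 1, 1) : V7) + (ex (Bits z)).2.2.2.2.2.1 • ((1, 1, 0, 0, 0, 1, 1) : V7) +
      (ex (Bits z)).2.2.2.2.2.2 • ((0, 1, 0, 1, 0, 0, 0) : V7) := by
  obtain ⟨r1, r2, r3, r4, r5, r6, r7⟩ := Row_values
  have m := fun {z w : K} (hz : z ≠ 0) (hw : w ≠ 0) => chars_mul hz hw
  have e1 := bit_eq_sum c4P (fun hz hw => (m hz hw).1) hz hS
  have e2 := bit_eq_sum c8P (fun hz hw => (m hz hw).2.1) hz hS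
  have e3 := bit_eq_sum c4N (fun hz hw => (m hz hw).2.2.1) hz hS
  have e4 := bit_eq_sum c8N (fun hz hw => (m hz hw).2.2.2.1) hz hS
  have e5 := bit_eq_sum x3 (fun hz hw => (m hz hw).2.2.2.2.1) hz hS
  have e6 := bit_eq_sum qP (fun hz hw => (m hz hw).2.2.2.2.2.1) hz hS
  have e7 := bit_eq_sum qN (fun hz hw => (m hz hw).2.2.2.2.2.2) hz hS
  simp only [Row, Prod.ext_iff] at r1 r2 r3 r4 r5 r6 r7
  obtain ⟨a1, a2, a3, a4, a5, a6, a7⟩ := r1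
  obtain ⟨b1, b2, b3, b4, b5, b6, b7⟩ := r2
  obtain ⟨d1, d2, d3, d4, d5, d6, d7⟩ := r3
  obtain ⟨f1, f2, f3, f4, f5, f6, f7⟩ := r4
  obtain ⟨g1, g2, g3, g4, g5, g6, g7⟩ := r5
  obtain ⟨h1, h2, h3, h4, h5, h6, h7⟩ := r6
  obtain ⟨i1, i2, i3, i4, i5, i6, i7⟩ := r7
  rw [a1, b1, d1, f1, g1, h1, i1] at e1
  rw [a2, b2, d2, f2, g2, h2, i2] at e2
  rw [a3, b3, d3, f3, g3, h3, i3] at e3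
  rw [a4, b4, d4, f4, g4, h4, i4] at e4
  rw [a5, b5, d5, f5, g5, h5, i5] at e5
  rw [a6, b6, d6, f6, g6, h6, i6] at e6
  rw [a7, b7, d7, f7, g7, h7, i7] at e7
  simp only [Row, e1, e2, e3, e4, e5, e6, e7, Prod.smul_mk, Prod.mk_add_mk, smul_eq_mul, mul_one,
    mul_zero, add_zero, zero_add]


end K41D

end DokchitserDokchitser2011

end Literature.Barriers.BirchSwinnertonDyer

end
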